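import Literature.Probability.LatticeModels.PointwiseScalingLimitTwoPointMono
import Literature.Probability.LatticeModels.CriticalScalingDimension
import HarnessLib

/-!
# Crux `IsingEuclidUpgradeR4NonGaussian` (stmt-CriticalPhenomena-0636), line `free-covariance-delta-dichotomy`:
# the two-point window on the counting region (helper obligation `stub_momentRatioWindow` of the
# registered stub `stub_momentRatioLowerBound`)

THEOREM-ONLY helper file (no definitions). For a pointwise scaling limit `S` of the critical Ising₃
correlators (renormalisation `ρ`) with non-degenerate two-point function and a non-coincident
quadruple `x`, there is a window `0 < ℓ ≤ U` such that for all small `δ > 0`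
(`stub_momentRatioWindow`):
* `ℓ ≤ ρ(δ)² ⟨σ_{x̃₀}σ_{x̃₁}⟩ ≤ U`, `ℓ ≤ ρ(δ)² ⟨σ_{x̃₂}σ_{x̃₃}⟩ ≤ U` (`x̃ᵢ = [xᵢ/δ]`);
* `ℓ ≤ ρ(δ)² ⟨σ_{x̃ᵢ}σ_v⟩ ≤ U` for every site `v = u + [z/δ]`, `u ∈ Λ_n`, `(n+1)δ ≤ 1`, of the
  COUNTING REGION around the far point `z = (∑ᵢ‖xᵢ‖ + 5)e₀`;
* `ρ(δ)² ⟨σ₀σ_{m e₀}⟩ ≤ U` for every axis site at macroscopic scale `δm ∈ [1/4, 1]`.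
Mechanism: the rescaled sites `δv` stay in the compact Euclidean ball `B̄(z,3)`, at sup-distance
`∈ [1, 2∑ᵢ‖xᵢ‖ + 8]` from every `xᵢ`; uniform convergence of the rescaled pair correlator on the
compact sets `{(xᵢ,q) : q ∈ B̄(z,3)}`, `{(0,te₀) : t ∈ [1/4,1]}` of non-coincident pairs and at the two
source pairs (the limit hypothesis at `n = 2`), and two-sided bounds on `S₂` there by the
Messager–Miracle-Solé comparison in the limit (tree theorem
`HasPointwiseScalingLimit.two_le_two_of_mul_norm_lt`) against the reference pairs `(0, e₀/4)`,
`(0, e₀/16)`, `(0, (3R+1)e₀)`.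

References: M. Aizenman, H. Duminil-Copin, Ann. Math. 194 (2021) = arXiv:1912.07973, §4.2 Lemma 4.4;
A. Messager, S. Miracle-Solé, J. Stat. Phys. 17 (1977).
-/

noncomputable section

open Filter Topology Set Function MeasureTheory Finset
open Literature.Probability.LatticeModels Literature.Probability.Percolation

namespace Summit.CriticalPhenomena.Ising3DConformalLimit.Cruxes.IsingEuclidUpgradeR4NonGaussian.FreeCovarianceDeltaDichotomy

/-! ## Geometry of the counting region and of the rescaled lattice -/

/-- A coordinate is bounded by the Euclidean norm. [folklore] -/
private theorem abs_apply_le_norm' (w : EuclideanSpace ℝ (Fin 3)) (i : Fin 3) : |w i| ≤ ‖w‖ := by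
  have := PiLp.norm_apply_le w i
  rwa [Real.norm_eq_abs] at this

/-- If all coordinates are `≤ b` in absolute value then `‖w‖₂ ≤ 2b`. [folklore] -/
private theorem norm_le_two_mul_of_abs_le' {w : EuclideanSpace ℝ (Fin 3)} {b : ℝ}
    (hb : ∀ i, |w i| ≤ b) : ‖w‖ ≤ 2 * b := by
  have hb0 : 0 ≤ b := (abs_nonneg _).trans (hb 0)
  rw [EuclideanSpace.norm_eq]
  have hs : ∑ i, ‖w i‖ ^ 2 ≤ (2 * b) ^ 2 := by
    have h' : ∀ i, ‖w i‖ ^ 2 ≤ b ^ 2 := fun i => by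
      rw [Real.norm_eq_abs]; exact pow_le_pow_left₀ (abs_nonneg _) (hb i) 2
    rw [Fin.sum_univ_three]
    nlinarith [h' 0, h' 1, h' 2]
  calc √(∑ i, ‖w i‖ ^ 2) ≤ √((2 * b) ^ 2) := Real.sqrt_le_sqrt hs
    _ = 2 * b := Real.sqrt_sq (by linarith)

/-- `‖û‖₂ ≤ 2‖u‖_∞` for a lattice site. [folklore] -/
private theorem norm_siteVec_le' (u : Site 3) : ‖siteVec u‖ ≤ 2 * Site.supNorm u :=
  norm_le_two_mul_of_abs_le' (b := (Site.supNorm u : ℝ)) fun i => by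
    have h : ((u i).natAbs : ℝ) ≤ Site.supNorm u := by exact_mod_cast Site.natAbs_le_supNorm u i
    have e : |siteVec u i| = ((u i).natAbs : ℝ) := by
      rw [siteVec_apply, Nat.cast_natAbs, Int.cast_abs]
    rwa [e]

/-- The sup norm is bounded by the Euclidean norm. [folklore] -/
private theorem norm_ofLp_le (w : EuclideanSpace ℝ (Fin 3)) : ‖WithLp.ofLp w‖ ≤ ‖w‖ :=
  (pi_norm_le_iff_of_nonneg (norm_nonneg _)).2 fun i => PiLp.norm_apply_le w i

/-- Coordinates of `t e₀`. [folklore] -/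
private theorem smul_unitVec_apply (t : ℝ) (j : Fin 3) :
    (t • EuclideanSpace.single (0 : Fin 3) (1:ℝ)) j = if j = 0 then t else 0 := by
  rw [PiLp.smul_apply, PiLp.single_apply, smul_eq_mul, mul_ite, mul_one, mul_zero]

/-- The sup norm of `t e₀` is `|t|`. [folklore] -/
private theorem norm_ofLp_smul_unitVec (t : ℝ) :
    ‖WithLp.ofLp (t • EuclideanSpace.single (0 : Fin 3) (1:ℝ))‖ = |t| := by
  rw [WithLp.ofLp_smul, norm_smul, Real.norm_eq_abs, PiLp.ofLp_single, Pi.norm_single, norm_one,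
    mul_one]

/-- The Euclidean norm of `t e₀` is `|t|`. [folklore] -/
private theorem norm_smul_unitVec (t : ℝ) :
    ‖t • EuclideanSpace.single (0 : Fin 3) (1:ℝ)‖ = |t| := by
  rw [norm_smul, Real.norm_eq_abs, PiLp.norm_single, norm_one, mul_one]

/-- `t e₀ ≠ 0` for `t ≠ 0`. [folklore] -/
private theorem smul_unitVec_ne_zero {t : ℝ} (ht : t ≠ 0) :
    t • EuclideanSpace.single (0 : Fin 3) (1:ℝ) ≠ 0 := by
  intro h
  have := congrArg (fun w : EuclideanSpace ℝ (Fin 3) => w 0) h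
  simp at this
  exact ht this

/-- The configuration `(0, t e₀)`, `t ≠ 0`, is non-coincident. [folklore] -/
private theorem zero_smul_unitVec_mem_nonCoincident {t : ℝ} (ht : t ≠ 0) :
    (![0, t • EuclideanSpace.single (0 : Fin 3) (1:ℝ)] : Fin 2 → EuclideanSpace ℝ (Fin 3)) ∈
      NonCoincident 3 2 :=
  pair_mem_nonCoincident (Ne.symm (smul_unitVec_ne_zero ht))

/-- The embedded axis site `m e₀`. [folklore] -/
private theorem siteVec_single (m : ℤ) :
    siteVec (Pi.single (0 : Fin 3) m : Site 3) = (m : ℝ) • EuclideanSpace.single (0 : Fin 3) (1:ℝ) := by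
  ext j
  rw [siteVec_apply, smul_unitVec_apply, Pi.single_apply]
  split_ifs <;> simp

/-- `siteVec` is additive. [folklore] -/
private theorem siteVec_add' (u v : Site 3) : siteVec (u + v) = siteVec u + siteVec v := by
  ext j; simp [siteVec_apply]

/-- **The counting region stays in the ball**: for `u ∈ Λ_n`, `(n+1)δ ≤ 1`, the rescaled site
`δ(u + [z/δ])` lies in the closed Euclidean ball `B̄(z, 3)`. [folklore] -/
private theorem smul_siteVec_mem_closedBall {δ : ℝ} (hδ : 0 < δ) (z : EuclideanSpace ℝ (Fin 3))
    {n : ℕ} (hn : ((n:ℝ) + 1) * δ ≤ 1) {u : Site 3} (hu : u ∈ box 3 n) :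
    δ • siteVec (u + latticeApprox δ z) ∈ Metric.closedBall z 3 := by
  rw [Metric.mem_closedBall, dist_eq_norm, siteVec_add', smul_add]
  have h1 : ‖δ • siteVec u‖ ≤ 2 * (n * δ) := by
    rw [norm_smul, Real.norm_of_nonneg hδ.le]
    have h := norm_siteVec_le' u
    have hun : (Site.supNorm u : ℝ) ≤ n := by exact_mod_cast mem_box_iff_supNorm_le.1 hu
    nlinarith
  have h2 : ‖δ • siteVec (latticeApprox δ z) - z‖ ≤ 2 * δ := by
    refine norm_le_two_mul_of_abs_le' fun j => ?_
    rw [PiLp.sub_apply, PiLp.smul_apply, siteVec_apply, smul_eq_mul]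
    exact abs_mul_latticeApprox_sub_le hδ z j
  calc ‖δ • siteVec u + δ • siteVec (latticeApprox δ z) - z‖
      = ‖δ • siteVec u + (δ • siteVec (latticeApprox δ z) - z)‖ := by rw [add_sub_assoc]
    _ ≤ ‖δ • siteVec u‖ + ‖δ • siteVec (latticeApprox δ z) - z‖ := norm_add_le _ _
    _ ≤ 2 * (n * δ) + 2 * δ := add_le_add h1 h2
    _ = 2 * ((n + 1) * δ) := by ring
    _ ≤ 3 := by linarith

/-- **Geometry of the ball `B̄(z, 3)`, `z = (∑ᵢ‖xᵢ‖ + 5) e₀`**: every point of the ball is at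
sup-distance between `1` and `2∑ᵢ‖xᵢ‖ + 8` from each marked point `xᵢ`. [folklore] -/
private theorem ball_geometry (x : Fin 4 → EuclideanSpace ℝ (Fin 3)) {q : EuclideanSpace ℝ (Fin 3)}
    (hq : q ∈ Metric.closedBall (((∑ i, ‖x i‖) + 5) • EuclideanSpace.single (0 : Fin 3) (1:ℝ)) 3)
    (i : Fin 4) :
    1 ≤ ‖WithLp.ofLp (x i) - WithLp.ofLp q‖ ∧
      ‖WithLp.ofLp (x i) - WithLp.ofLp q‖ ≤ 2 * (∑ i, ‖x i‖) + 8 := by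
  set Rx : ℝ := ∑ i, ‖x i‖ with hRx
  have hRx0 : 0 ≤ Rx := Finset.sum_nonneg fun j _ => norm_nonneg (x j)
  have hxi : ‖x i‖ ≤ Rx := Finset.single_le_sum (fun j _ => norm_nonneg (x j)) (Finset.mem_univ i)
  rw [Metric.mem_closedBall, dist_eq_norm] at hq
  constructor
  · have h1 : |(q - (Rx + 5) • EuclideanSpace.single (0 : Fin 3) (1:ℝ)) 0| ≤ 3 :=
      (abs_apply_le_norm' _ 0).trans hq
    rw [PiLp.sub_apply, smul_unitVec_apply, if_pos rfl] at h1
    have hx0 : |x i 0| ≤ Rx := (abs_apply_le_norm' _ 0).trans hxi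
    have key : 1 ≤ |(WithLp.ofLp (x i) - WithLp.ofLp q) 0| := by
      rw [Pi.sub_apply]
      rw [abs_le] at h1 hx0
      rw [le_abs]
      right
      linarith [h1.1, hx0.2]
    have h2 := norm_le_pi_norm (WithLp.ofLp (x i) - WithLp.ofLp q) 0
    rw [Real.norm_eq_abs] at h2
    exact key.trans h2
  · set z : EuclideanSpace ℝ (Fin 3) := (Rx + 5) • EuclideanSpace.single (0 : Fin 3) (1:ℝ) with hz
    have hz' : ‖z‖ = Rx + 5 := by rw [hz, norm_smul_unitVec, abs_of_nonneg (by linarith)]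
    have hq' : ‖q‖ ≤ 3 + (Rx + 5) := by
      calc ‖q‖ = ‖(q - z) + z‖ := by rw [sub_add_cancel]
        _ ≤ ‖q - z‖ + ‖z‖ := norm_add_le _ _
        _ ≤ 3 + (Rx + 5) := add_le_add hq hz'.le
    calc ‖WithLp.ofLp (x i) - WithLp.ofLp q‖
        ≤ ‖WithLp.ofLp (x i)‖ + ‖WithLp.ofLp q‖ := norm_sub_le _ _
      _ ≤ ‖x i‖ + ‖q‖ := add_le_add (norm_ofLp_le _) (norm_ofLp_le _)
      _ ≤ Rx + (3 + (Rx + 5)) := add_le_add hxi hq'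
      _ = 2 * Rx + 8 := by ring

/-- The rescaled pair correlator at `(p, δv̂)`, `v` a lattice site, is `ρ(δ)² ⟨σ_{[p/δ]}σ_v⟩`.
[folklore] -/
private theorem rescaledCorrelator_pair_site {δ : ℝ} (hδ : 0 < δ) (ρ : ℝ → ℝ)
    (p : EuclideanSpace ℝ (Fin 3)) (v : Site 3) :
    rescaledCorrelator (criticalCorr 3) ρ 2 δ ![p, δ • siteVec v] =
      ρ δ ^ 2 * criticalCorr 3 2 ![latticeApprox δ p, v] := by
  rw [rescaledCorrelator_apply, latticeApprox_comp_two]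
  simp only [Matrix.cons_val_zero, Matrix.cons_val_one, Matrix.cons_val_fin_one,
    latticeApprox_smul_siteVec hδ]

/-- The rescaled pair correlator at `(0, δv̂)` is `ρ(δ)² ⟨σ₀σ_v⟩`. [folklore] -/
private theorem rescaledCorrelator_zero_site {δ : ℝ} (hδ : 0 < δ) (ρ : ℝ → ℝ) (v : Site 3) :
    rescaledCorrelator (criticalCorr 3) ρ 2 δ ![0, δ • siteVec v] =
      ρ δ ^ 2 * criticalTwoPoint 3 v := by
  rw [rescaledCorrelator_pair_site hδ, latticeApprox_zero, criticalCorr_two]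

/-- The rescaled pair correlator at a pair configuration. [folklore] -/
private theorem rescaledCorrelator_pair (δ : ℝ) (ρ : ℝ → ℝ) (p q : EuclideanSpace ℝ (Fin 3)) :
    rescaledCorrelator (criticalCorr 3) ρ 2 δ ![p, q] =
      ρ δ ^ 2 * criticalCorr 3 2 ![latticeApprox δ p, latticeApprox δ q] := by
  rw [rescaledCorrelator_apply, latticeApprox_comp_two]
  rfl

/-- The configurations `(p, q)`, `q` in a compact set, form a compact set. [folklore] -/
private theorem isCompact_pair_image (p : EuclideanSpace ℝ (Fin 3))
    {T : Set (EuclideanSpace ℝ (Fin 3))} (hT : IsCompact T) :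
    IsCompact ((fun q : EuclideanSpace ℝ (Fin 3) =>
      (![p, q] : Fin 2 → EuclideanSpace ℝ (Fin 3))) '' T) := by
  refine hT.image (continuous_pi fun i => ?_)
  fin_cases i
  · simpa using continuous_const
  · exact (continuous_id : Continuous fun y : EuclideanSpace ℝ (Fin 3) => y)

/-- The axis segment `{(0, t e₀) : 1/4 ≤ t ≤ 1}` is compact. [folklore] -/
private theorem isCompact_axis_segment :
    IsCompact ((fun t : ℝ =>
      (![0, t • EuclideanSpace.single (0 : Fin 3) (1:ℝ)] : Fin 2 → EuclideanSpace ℝ (Fin 3))) ''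
      Set.Icc (1/4 : ℝ) 1) := by
  refine isCompact_Icc.image (continuous_pi fun i => ?_)
  fin_cases i
  · simpa using continuous_const
  · simp only [Fin.mk_one, Matrix.cons_val_one, Matrix.cons_val_fin_one]
    exact continuous_id.smul continuous_const

/-- **Uniform closeness on a compact set of non-coincident pairs** (the limit hypothesis at
`n = 2`). [folklore] -/
private theorem eventually_abs_sub_lt_of_isCompact {ρ : ℝ → ℝ} {S : CorrFamily 3}
    (hlim : HasPointwiseScalingLimit (criticalCorr 3) ρ S)
    {K : Set (Fin 2 → EuclideanSpace ℝ (Fin 3))} (hKc : IsCompact K) (hKs : K ⊆ NonCoincident 3 2)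
    {ε : ℝ} (hε : 0 < ε) :
    ∀ᶠ δ in 𝓝[>] (0:ℝ), ∀ y ∈ K, |S 2 y - rescaledCorrelator (criticalCorr 3) ρ 2 δ y| < ε := by
  have hU : TendstoUniformlyOn (rescaledCorrelator (criticalCorr 3) ρ 2) (S 2) (𝓝[>] 0) K :=
    (tendstoLocallyUniformlyOn_iff_forall_isCompact (isOpen_nonCoincident 3 2)).1 (hlim 2) K hKs hKc
  filter_upwards [Metric.tendstoUniformlyOn_iff.1 hU ε hε] with δ hδ y hy
  have h := hδ y hy
  rwa [Real.dist_eq] at h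

/-- Pointwise closeness at one non-coincident pair. [folklore] -/
private theorem eventually_abs_sub_lt_at {ρ : ℝ → ℝ} {S : CorrFamily 3}
    (hlim : HasPointwiseScalingLimit (criticalCorr 3) ρ S) {y : Fin 2 → EuclideanSpace ℝ (Fin 3)}
    (hy : y ∈ NonCoincident 3 2) {ε : ℝ} (hε : 0 < ε) :
    ∀ᶠ δ in 𝓝[>] (0:ℝ), |S 2 y - rescaledCorrelator (criticalCorr 3) ρ 2 δ y| < ε := by
  have h := (Metric.tendsto_nhds.1 ((hlim 2).tendsto_at hy)) ε hε
  filter_upwards [h] with δ hδ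
  rwa [Real.dist_eq, abs_sub_comm] at hδ

/-! ## The window -/

/-- **Helper obligation `stub_momentRatioWindow` — the two-point window on the counting region.**
For a non-degenerate pointwise scaling limit of `criticalCorr 3` and a non-coincident quadruple `x`
there are `0 < ℓ ≤ U` such that for all small `δ > 0`: `ρ(δ)²⟨σ_{x̃₀}σ_{x̃₁}⟩`,
`ρ(δ)²⟨σ_{x̃₂}σ_{x̃₃}⟩ ∈ [ℓ, U]`; `ρ(δ)²⟨σ_{x̃ᵢ}σ_{u+[z/δ]}⟩ ∈ [ℓ, U]` for all `u ∈ Λ_n`,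
`(n+1)δ ≤ 1`, `z = (∑ᵢ‖xᵢ‖+5)e₀`; and `ρ(δ)²⟨σ₀σ_{me₀}⟩ ≤ U` whenever `δm ∈ [1/4, 1]`
(uniform convergence on compact sets of non-coincident pairs + Messager–Miracle-Solé in the limit).
[cite: MessagerMiracleSoleJSP1977, Theorem (monotonicity)] -/
theorem stub_momentRatioWindow :
    ∀ (ρ : ℝ → ℝ) (S : CorrFamily 3), HasPointwiseScalingLimit (criticalCorr 3) ρ S →
      IsNondegenerateTwoPoint S → ∀ x ∈ NonCoincident 3 4,
      ∃ ℓ U : ℝ, 0 < ℓ ∧ ℓ ≤ U ∧ ∀ᶠ δ in 𝓝[>] (0:ℝ),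
        (ℓ ≤ ρ δ ^ 2 * criticalCorr 3 2 ![latticeApprox δ (x 0), latticeApprox δ (x 1)] ∧
          ρ δ ^ 2 * criticalCorr 3 2 ![latticeApprox δ (x 0), latticeApprox δ (x 1)] ≤ U) ∧
        (ℓ ≤ ρ δ ^ 2 * criticalCorr 3 2 ![latticeApprox δ (x 2), latticeApprox δ (x 3)] ∧
          ρ δ ^ 2 * criticalCorr 3 2 ![latticeApprox δ (x 2), latticeApprox δ (x 3)] ≤ U) ∧
        (∀ n : ℕ, ((n:ℝ) + 1) * δ ≤ 1 → ∀ i : Fin 4, ∀ u ∈ box 3 n,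
          ℓ ≤ ρ δ ^ 2 * criticalCorr 3 2 ![latticeApprox δ (x i),
            u + latticeApprox δ (((∑ j, ‖x j‖) + 5) • EuclideanSpace.single (0 : Fin 3) (1:ℝ))] ∧
          ρ δ ^ 2 * criticalCorr 3 2 ![latticeApprox δ (x i),
            u + latticeApprox δ (((∑ j, ‖x j‖) + 5) • EuclideanSpace.single (0 : Fin 3) (1:ℝ))] ≤ U) ∧
        (∀ m : ℕ, 1/4 ≤ δ * m → δ * m ≤ 1 →
          ρ δ ^ 2 * criticalTwoPoint 3 (Pi.single (0 : Fin 3) (m : ℤ)) ≤ U) := by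
  intro ρ S hlim hnd x hx
  have hinj : Function.Injective x := hx
  set e₀ : EuclideanSpace ℝ (Fin 3) := EuclideanSpace.single (0 : Fin 3) (1:ℝ) with he₀
  /- constants -/
  set Rx : ℝ := ∑ i, ‖x i‖ with hRx
  have hRx0 : 0 ≤ Rx := Finset.sum_nonneg fun j _ => norm_nonneg (x j)
  set Rb : ℝ := 2 * Rx + 8 with hRb
  have hRb0 : 0 < Rb := by rw [hRb]; linarith only [hRx0]
  set z : EuclideanSpace ℝ (Fin 3) := (Rx + 5) • e₀ with hz
  set Ball : Set (EuclideanSpace ℝ (Fin 3)) := Metric.closedBall z 3 with hBall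
  -- the two source pairs
  have h01 : (![x 0, x 1] : Fin 2 → EuclideanSpace ℝ (Fin 3)) ∈ NonCoincident 3 2 :=
    pair_mem_nonCoincident fun h => absurd (hinj h) (by decide)
  have h23 : (![x 2, x 3] : Fin 2 → EuclideanSpace ℝ (Fin 3)) ∈ NonCoincident 3 2 :=
    pair_mem_nonCoincident fun h => absurd (hinj h) (by decide)
  have hsab : 0 < S 2 ![x 0, x 1] := hnd _ h01
  have hsce : 0 < S 2 ![x 2, x 3] := hnd _ h23
  have hmb : 0 < S 2 ![0, (3 * Rb + 1) • e₀] :=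
    hnd _ (zero_smul_unitVec_mem_nonCoincident (ne_of_gt (by linarith only [hRb0])))
  have hMb : 0 < S 2 ![0, (1/4:ℝ) • e₀] :=
    hnd _ (zero_smul_unitVec_mem_nonCoincident (by norm_num))
  have hMs : 0 < S 2 ![0, (1/16:ℝ) • e₀] :=
    hnd _ (zero_smul_unitVec_mem_nonCoincident (by norm_num))
  -- geometry of the ball
  have hball_ne : ∀ i : Fin 4, ∀ q ∈ Ball, x i ≠ q := by
    intro i q hq h
    obtain ⟨hlo, -⟩ := ball_geometry x hq i
    rw [h, sub_self, norm_zero] at hlo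
    exact absurd hlo (by norm_num)
  -- Messager–Miracle-Solé in the limit: two-sided bounds on the ball, upper bound on the segment
  have hball_bounds : ∀ i : Fin 4, ∀ q ∈ Ball,
      S 2 ![0, (3 * Rb + 1) • e₀] ≤ S 2 ![x i, q] ∧ S 2 ![x i, q] ≤ S 2 ![0, (1/4:ℝ) • e₀] := by
    intro i q hq
    obtain ⟨hlo, hhi⟩ := ball_geometry x hq i
    have hnc : (![x i, q] : Fin 2 → EuclideanSpace ℝ (Fin 3)) ∈ NonCoincident 3 2 :=
      pair_mem_nonCoincident (hball_ne i q hq)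
    constructor
    · refine hlim.two_le_two_of_mul_norm_lt (by norm_num) hnc
        (zero_smul_unitVec_mem_nonCoincident (ne_of_gt (by linarith only [hRb0]))) ?_
      simp only [Matrix.cons_val_zero, Matrix.cons_val_one, Matrix.cons_val_fin_one,
        WithLp.ofLp_zero, zero_sub, norm_neg, he₀, norm_ofLp_smul_unitVec, Nat.cast_ofNat]
      rw [abs_of_pos (by linarith only [hRb0])]
      linarith only [hhi, hRb, hRx]
    · refine hlim.two_le_two_of_mul_norm_lt (by norm_num)
        (zero_smul_unitVec_mem_nonCoincident (by norm_num : (1/4:ℝ) ≠ 0)) hnc ?_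
      simp only [Matrix.cons_val_zero, Matrix.cons_val_one, Matrix.cons_val_fin_one,
        WithLp.ofLp_zero, zero_sub, norm_neg, he₀, norm_ofLp_smul_unitVec, Nat.cast_ofNat]
      rw [abs_of_pos (by norm_num)]
      linarith only [hlo]
  have hseg_bound : ∀ t ∈ Set.Icc (1/4:ℝ) 1, S 2 ![0, t • e₀] ≤ S 2 ![0, (1/16:ℝ) • e₀] := by
    intro t ht
    refine hlim.two_le_two_of_mul_norm_lt (by norm_num)
      (zero_smul_unitVec_mem_nonCoincident (by norm_num : (1/16:ℝ) ≠ 0))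
      (zero_smul_unitVec_mem_nonCoincident (ne_of_gt (by linarith only [ht.1]))) ?_
    simp only [Matrix.cons_val_zero, Matrix.cons_val_one, Matrix.cons_val_fin_one,
      WithLp.ofLp_zero, zero_sub, norm_neg, he₀, norm_ofLp_smul_unitVec, Nat.cast_ofNat]
    rw [abs_of_pos (by norm_num), abs_of_pos (by linarith only [ht.1])]
    linarith only [ht.1]
  /- the window `[ℓ, U]` -/
  set ℓ : ℝ := min (min (S 2 ![x 0, x 1]) (S 2 ![x 2, x 3])) (S 2 ![0, (3 * Rb + 1) • e₀]) / 2
    with hℓ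
  have hmin1 := min_le_left (min (S 2 ![x 0, x 1]) (S 2 ![x 2, x 3])) (S 2 ![0, (3 * Rb + 1) • e₀])
  have hmin2 := min_le_right (min (S 2 ![x 0, x 1]) (S 2 ![x 2, x 3])) (S 2 ![0, (3 * Rb + 1) • e₀])
  have hmin3 := min_le_left (S 2 ![x 0, x 1]) (S 2 ![x 2, x 3])
  have hmin4 := min_le_right (S 2 ![x 0, x 1]) (S 2 ![x 2, x 3])
  have hℓpos : 0 < ℓ := by
    rw [hℓ]; exact half_pos (lt_min (lt_min hsab hsce) hmb)
  have hℓsab : 2 * ℓ ≤ S 2 ![x 0, x 1] := by rw [hℓ]; linarith only [hmin1, hmin3]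
  have hℓsce : 2 * ℓ ≤ S 2 ![x 2, x 3] := by rw [hℓ]; linarith only [hmin1, hmin4]
  have hℓmb : 2 * ℓ ≤ S 2 ![0, (3 * Rb + 1) • e₀] := by rw [hℓ]; linarith only [hmin2]
  set U : ℝ := S 2 ![x 0, x 1] + S 2 ![x 2, x 3] + S 2 ![0, (1/4:ℝ) • e₀] +
    S 2 ![0, (1/16:ℝ) • e₀] + ℓ with hU
  refine ⟨ℓ, U, hℓpos, by rw [hU]; linarith only [hsab, hsce, hMb, hMs], ?_⟩
  /- eventualities in `δ` -/
  have hKc : ∀ i : Fin 4, IsCompact ((fun q : EuclideanSpace ℝ (Fin 3) =>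
      (![x i, q] : Fin 2 → EuclideanSpace ℝ (Fin 3))) '' Ball) :=
    fun i => isCompact_pair_image (x i) (isCompact_closedBall z 3)
  have hKs : ∀ i : Fin 4, (fun q : EuclideanSpace ℝ (Fin 3) =>
      (![x i, q] : Fin 2 → EuclideanSpace ℝ (Fin 3))) '' Ball ⊆ NonCoincident 3 2 := by
    rintro i _ ⟨q, hq, rfl⟩
    exact pair_mem_nonCoincident (hball_ne i q hq)
  have E1 : ∀ᶠ δ in 𝓝[>] (0:ℝ), ∀ i : Fin 4, ∀ q ∈ Ball,
      |S 2 ![x i, q] - rescaledCorrelator (criticalCorr 3) ρ 2 δ ![x i, q]| < ℓ := by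
    refine eventually_all.2 fun i => ?_
    filter_upwards [eventually_abs_sub_lt_of_isCompact hlim (hKc i) (hKs i) hℓpos] with δ hδ q hq
    exact hδ _ ⟨q, hq, rfl⟩
  have E2a := eventually_abs_sub_lt_at hlim h01 hℓpos
  have E2b := eventually_abs_sub_lt_at hlim h23 hℓpos
  have hSegs : (fun t : ℝ => (![0, t • e₀] : Fin 2 → EuclideanSpace ℝ (Fin 3))) ''
      Set.Icc (1/4:ℝ) 1 ⊆ NonCoincident 3 2 := by
    rintro _ ⟨t, ht, rfl⟩
    exact zero_smul_unitVec_mem_nonCoincident (ne_of_gt (by linarith only [ht.1]))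
  have E3 : ∀ᶠ δ in 𝓝[>] (0:ℝ), ∀ t ∈ Set.Icc (1/4:ℝ) 1,
      |S 2 ![0, t • e₀] - rescaledCorrelator (criticalCorr 3) ρ 2 δ ![0, t • e₀]| < ℓ := by
    filter_upwards [eventually_abs_sub_lt_of_isCompact hlim isCompact_axis_segment hSegs hℓpos]
      with δ hδ t ht
    exact hδ _ ⟨t, ht, rfl⟩
  have E4 : ∀ᶠ δ in 𝓝[>] (0:ℝ), δ ∈ Set.Ioo (0:ℝ) 1 := Ioo_mem_nhdsGT one_pos
  filter_upwards [E1, E2a, E2b, E3, E4] with δ h1 h2a h2b h3 h4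
  have hδpos : 0 < δ := h4.1
  refine ⟨?_, ?_, ?_, ?_⟩
  · rw [rescaledCorrelator_pair, abs_lt] at h2a
    constructor
    · linarith only [h2a.2, hℓsab]
    · rw [hU]; linarith only [h2a.1, hsce, hMb, hMs]
  · rw [rescaledCorrelator_pair, abs_lt] at h2b
    constructor
    · linarith only [h2b.2, hℓsce]
    · rw [hU]; linarith only [h2b.1, hsab, hMb, hMs]
  · intro n hn i u hu
    have hq : δ • siteVec (u + latticeApprox δ z) ∈ Ball := smul_siteVec_mem_closedBall hδpos z hn hu
    have hcl := h1 i _ hq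
    rw [rescaledCorrelator_pair_site hδpos, abs_lt] at hcl
    obtain ⟨hlo, hhi⟩ := hball_bounds i _ hq
    constructor
    · linarith only [hcl.2, hlo, hℓmb]
    · rw [hU]; linarith only [hcl.1, hhi, hsab, hsce, hMs]
  · intro m hm4 hm1
    have hcfg : δ • siteVec (Pi.single (0 : Fin 3) (m : ℤ) : Site 3) = (δ * m) • e₀ := by
      rw [siteVec_single, smul_smul, Int.cast_natCast]
    have hcl := h3 (δ * m) ⟨hm4, hm1⟩
    have hb := hseg_bound (δ * m) ⟨hm4, hm1⟩
    rw [← hcfg, rescaledCorrelator_zero_site hδpos, abs_lt] at hcl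
    rw [← hcfg] at hb
    rw [hU]; linarith only [hcl.1, hb, hsab, hsce, hMb]

end Summit.CriticalPhenomena.Ising3DConformalLimit.Cruxes.IsingEuclidUpgradeR4NonGaussian.FreeCovarianceDeltaDichotomy

end
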